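import Summits.Parity.BatemanHorn.Theorems.SoloInformedHooleyShiftBlocks
import Summits.Parity.BatemanHorn.Theorems.SoloInformedTrapezoidSecondVariation
import Summits.Parity.BatemanHorn.Theorems.SoloInformedRootMertensConstant

/-!
# The local `ℓ¹`-mean hypothesis for Hooley sums, and the block tools of the trapezoid method

Informed soloist `solo-Parity-informed` (session 143), conjunct `BatemanHorn`, the `d ≥ 3` rung BELOW the parity
wall.  This file introduces the hypothesis that the trapezoid method (`SoloInformedTrapezoidReduction`) consumes
and the modulus-block tools of its assembly:

* `HooleyMeanLocal g θ η`: an `ℓ¹`-MEAN (over frequencies `1 ≤ |h| ≤ H ≤ E^θ`) power saving `E^{1−η}` for the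
  UNSHIFTED Hooley sums `S_g(±h; e) = ∑_{g(ν)≡0 (e)} e(±hν/e)` summed over dyadic blocks of moduli `e ∈ (E, E']`,
  `E' ≤ 2E`.  It is implied by the sup-norm hypothesis `HooleyShiftUniform g η` of `SoloInformedHooleyShift*`
  for every `θ ≤ 1` (`hooleyMeanLocal_of_hooleyShiftUniform`) and is monotone in both exponents; compared with
  `HooleyShiftUniform` it has NO shifts `b`, needs only an average over `h`, and only frequencies `|h| ≤ E^θ`.
* `h`-periodicity of `S_g(h; e)` and of the trapezoid kernel, and the FOLD of `∑_{0<h<e}` into `1 ≤ h ≤ (e−1)/2`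
  and `−e/2 ≤ −k ≤ −1` (`sum_Ico_trapKernel_mul_hooleySum_eq_fold`);
* the harmonic-weight lemma `∑_{h≤H} x_h/h ≤ M(2 + log H)` from partial-sum bounds `∑_{h≤H'} x_h ≤ M·H'`
  (`sum_div_le_of_partial_sums_le`, via `sum_div_eq_abel` of `SoloInformedRootMertensConstant`) — how an
  `ℓ¹`-mean bound is used against weights `≍ 1/|h|`;
* the TERMWISE Abel inequality in the modulus (`norm_sum_Ioc_mul_le_abel_termwise`) and its `h`-summed form with
  a FACTORISED variation bound `|c_{e+1}(h) − c_e(h)| ≤ W₁/(e|h|) + W₂/e³` (`sum_norm_sum_Ioc_mul_le_of_factorised`):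
  no supremum over the partial-sum index is taken, so an `ℓ¹`-in-`h` hypothesis at each FIXED partial-sum index
  suffices;
* the termwise TAIL bound `∑_{H<|h|≤e/2} |K_N(Φ; e(−h/e))| ≤ V₂(Φ)·e²/(4(H+1))` (`sum_norm_kernelSum_tail_le`).
-/

namespace Summit.Parity.BatemanHorn.Theorems

open Finset Polynomial

/-! ### The hypothesis -/

/-- **The local `ℓ¹`-mean hypothesis** with frequency range exponent `θ` and power saving `η`:
`∃ C, ∀ 1 ≤ E ≤ E' ≤ 2E, ∀ H ≤ E^θ: ∑_{1≤h≤H} (|∑_{E<e≤E'} S_g(h;e)| + |∑_{E<e≤E'} S_g(−h;e)|) ≤ C·H·E^{1−η}`.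
[this work] -/
def HooleyMeanLocal (g : ℤ[X]) (θ η : ℝ) : Prop :=
  ∃ C : ℝ, ∀ E E' H : ℕ, 1 ≤ E → E ≤ E' → E' ≤ 2 * E → (H : ℝ) ≤ (E : ℝ) ^ θ →
    ∑ h ∈ Icc 1 H, (‖∑ e ∈ Ioc E E', hooleySum g e h‖ + ‖∑ e ∈ Ioc E E', hooleySum g e (-(h : ℤ))‖)
      ≤ C * H * (E : ℝ) ^ (1 - η)

/-- The constant may be taken nonnegative. [this work] -/
theorem HooleyMeanLocal.exists_nonneg {g : ℤ[X]} {θ η : ℝ} (hyp : HooleyMeanLocal g θ η) :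
    ∃ C : ℝ, 0 ≤ C ∧ ∀ E E' H : ℕ, 1 ≤ E → E ≤ E' → E' ≤ 2 * E → (H : ℝ) ≤ (E : ℝ) ^ θ →
      ∑ h ∈ Icc 1 H, (‖∑ e ∈ Ioc E E', hooleySum g e h‖ + ‖∑ e ∈ Ioc E E', hooleySum g e (-(h : ℤ))‖)
        ≤ C * H * (E : ℝ) ^ (1 - η) := by
  obtain ⟨C, hC⟩ := hyp
  refine ⟨max C 0, le_max_right _ _, fun E E' H hE hEE' hE' hH => (hC E E' H hE hEE' hE' hH).trans ?_⟩
  have : 0 ≤ (H : ℝ) * (E : ℝ) ^ (1 - η) := by positivity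
  nlinarith [le_max_left C 0]

/-- Monotonicity in the saving. [this work] -/
theorem HooleyMeanLocal.mono_right {g : ℤ[X]} {θ η η' : ℝ} (hle : η' ≤ η) (hyp : HooleyMeanLocal g θ η) :
    HooleyMeanLocal g θ η' := by
  obtain ⟨C, hC0, hC⟩ := hyp.exists_nonneg
  refine ⟨C, fun E E' H hE hEE' hE' hH => (hC E E' H hE hEE' hE' hH).trans ?_⟩
  have hE1 : (1 : ℝ) ≤ E := by exact_mod_cast hE
  exact mul_le_mul_of_nonneg_left (Real.rpow_le_rpow_of_exponent_le hE1 (by linarith)) (by positivity)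

/-- Monotonicity in the frequency range. [this work] -/
theorem HooleyMeanLocal.mono_left {g : ℤ[X]} {θ θ' η : ℝ} (hle : θ' ≤ θ) (hyp : HooleyMeanLocal g θ η) :
    HooleyMeanLocal g θ' η := by
  obtain ⟨C, hC⟩ := hyp
  refine ⟨C, fun E E' H hE hEE' hE' hH => hC E E' H hE hEE' hE' (hH.trans ?_)⟩
  have hE1 : (1 : ℝ) ≤ E := by exact_mod_cast hE
  exact Real.rpow_le_rpow_of_exponent_le hE1 hle

/-- **`HooleyShiftUniform g η ⟹ HooleyMeanLocal g θ η`** for every `θ ≤ 1` (take the shift `b = 0`).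
[this work] -/
theorem hooleyMeanLocal_of_hooleyShiftUniform {g : ℤ[X]} {θ η : ℝ} (hθ : θ ≤ 1)
    (hyp : HooleyShiftUniform g η) : HooleyMeanLocal g θ η := by
  obtain ⟨C, hC⟩ := hyp
  have hC0 : ∀ E : ℕ, 1 ≤ E → 0 ≤ C * (E : ℝ) ^ (1 - η) := fun E hE =>
    (norm_nonneg _).trans (hC 1 0 E E one_ne_zero hE le_rfl (by omega) (by simp; omega) le_rfl (by positivity))
  refine ⟨2 * C, fun E E' H hE hEE' hE' hH => ?_⟩
  have hE1 : (1 : ℝ) ≤ E := by exact_mod_cast hE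
  have hHE : (H : ℝ) ≤ E := hH.trans (by simpa using Real.rpow_le_rpow_of_exponent_le hE1 hθ)
  have hHE' : H ≤ E := by exact_mod_cast hHE
  have key : ∀ h ∈ Icc 1 H,
      ‖∑ e ∈ Ioc E E', hooleySum g e h‖ + ‖∑ e ∈ Ioc E E', hooleySum g e (-(h : ℤ))‖
        ≤ 2 * (C * (E : ℝ) ^ (1 - η)) := by
    intro h hh
    rw [mem_Icc] at hh
    have hh0 : (h : ℤ) ≠ 0 := by exact_mod_cast (show h ≠ 0 by omega)
    have hhE : |(h : ℤ)| ≤ E := by rw [abs_of_nonneg (by positivity)]; exact_mod_cast hh.2.trans hHE'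
    have h1 := hC h 0 E E' hh0 hE hEE' hE' hhE le_rfl (by positivity)
    have h2 := hC (-(h : ℤ)) 0 E E' (neg_ne_zero.mpr hh0) hE hEE' hE' (by rwa [abs_neg]) le_rfl
      (by positivity)
    simp only [hooleySumShift_zero] at h1 h2
    linarith
  refine (sum_le_sum key).trans ?_
  rw [sum_const, Nat.card_Icc, nsmul_eq_mul]
  have := hC0 E hE
  push_cast
  nlinarith

/-! ### Periodicity in the frequency and the fold -/

/-- `S_g(h + e; e) = S_g(h; e)`. [folklore] -/
theorem hooleySum_add_modulus (g : ℤ[X]) (e : ℕ) (h : ℤ) : hooleySum g e (h + e) = hooleySum g e h := by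
  rw [← hooleySumShift_zero, ← hooleySumShift_zero g e h, hooleySumShift_add_modulus_freq]

/-- The trapezoid kernel is `e`-periodic in the frequency. [this work] -/
theorem trapKernel_add_modulus (g : ℤ[X]) (Δ : ℝ) (X₀ D e : ℕ) (h : ℤ) :
    trapKernel g Δ X₀ D e (h + e) = trapKernel g Δ X₀ D e h := by
  unfold trapKernel
  refine sum_congr rfl fun m _ => ?_
  rw [show -((h + e) * (m : ℤ)) = -(h * m) + e * (-(m : ℤ)) by ring, eAdd_add_modulus_mul]

/-- **The fold**: `∑_{0<h<e} K_e(h)S_g(h;e) = ∑_{1≤h≤(e−1)/2} K_e(h)S_g(h;e) + ∑_{1≤k≤e/2} K_e(−k)S_g(−k;e)`.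
[this work] -/
theorem sum_Ico_trapKernel_mul_hooleySum_eq_fold (g : ℤ[X]) (Δ : ℝ) (X₀ D e : ℕ) :
    ∑ h ∈ Ico 1 e, trapKernel g Δ X₀ D e h * hooleySum g e h
      = ∑ h ∈ Icc 1 ((e - 1) / 2), trapKernel g Δ X₀ D e h * hooleySum g e h
        + ∑ k ∈ Icc 1 (e / 2), trapKernel g Δ X₀ D e (-(k : ℤ)) * hooleySum g e (-(k : ℤ)) := by
  have := sum_Ico_eq_sum_fold (fun h : ℤ => trapKernel g Δ X₀ D e h * hooleySum g e h) (e := e)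
    (fun k => by simp only [trapKernel_add_modulus, hooleySum_add_modulus])
  simpa using this

/-! ### The harmonic-weight lemma -/

/-- **Harmonic weights against partial-sum bounds**: if `∑_{h≤H'} x_h ≤ M·H'` for all `1 ≤ H' ≤ H` (`M ≥ 0`), then
`∑_{h≤H} x_h/h ≤ M·(2 + log H)`. [folklore] -/
theorem sum_div_le_of_partial_sums_le {x : ℕ → ℝ} {M : ℝ} (hM : 0 ≤ M) {H : ℕ}
    (hX : ∀ H' ∈ Icc 1 H, ∑ h ∈ Icc 1 H', x h ≤ M * H') :
    ∑ h ∈ Icc 1 H, x h / h ≤ M * (2 + Real.log H) := by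
  rcases Nat.eq_zero_or_pos H with rfl | hH
  · simp; positivity
  have hH' : (0 : ℝ) < H := by exact_mod_cast hH
  rw [RootMertens.sum_div_eq_abel]
  have h1 : (∑ h ∈ Icc 1 H, x h) / H ≤ M := by
    rw [div_le_iff₀ hH']
    exact hX H (mem_Icc.mpr ⟨hH, le_rfl⟩)
  have h2 : ∑ j ∈ Ico 1 H, (∑ h ∈ Icc 1 j, x h) / ((j : ℝ) * ((j : ℝ) + 1))
      ≤ ∑ j ∈ Ico 1 H, M * (1 / ((j : ℝ) + 1)) := by
    refine sum_le_sum fun j hj => ?_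
    rw [mem_Ico] at hj
    have hj' : (0 : ℝ) < j := by exact_mod_cast hj.1
    rw [div_le_iff₀ (by positivity)]
    calc ∑ h ∈ Icc 1 j, x h ≤ M * j := hX j (mem_Icc.mpr ⟨hj.1, hj.2.le⟩)
      _ = M * (1 / ((j : ℝ) + 1)) * ((j : ℝ) * ((j : ℝ) + 1)) := by field_simp
  have h3 : ∑ j ∈ Ico 1 H, M * (1 / ((j : ℝ) + 1)) ≤ M * (1 + Real.log H) := by
    rw [← mul_sum]
    refine mul_le_mul_of_nonneg_left ?_ hM
    have := sum_Ioo_one_div_succ_le 0 H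
    rwa [show Ioo 0 H = Ico 1 H from by ext j; simp [mem_Ioo, mem_Ico]; omega] at this
  linarith

/-! ### Abel summation in the modulus, termwise -/

/-- **Termwise Abel inequality**: `‖∑_{E<e≤E'} c(e)s(e)‖ ≤ ‖c(E')‖·‖T(E')‖ + ∑_{E<e<E'} ‖c(e+1) − c(e)‖·‖T(e)‖`,
`T(t) = ∑_{E<i≤t} s(i)`. [folklore] -/
theorem norm_sum_Ioc_mul_le_abel_termwise (c s : ℕ → ℂ) {E E' : ℕ} (hEE' : E ≤ E') :
    ‖∑ e ∈ Ioc E E', c e * s e‖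
      ≤ ‖c E'‖ * ‖∑ e ∈ Ioc E E', s e‖ + ∑ e ∈ Ioo E E', ‖c (e + 1) - c e‖ * ‖∑ i ∈ Ioc E e, s i‖ := by
  rcases eq_or_lt_of_le hEE' with heq | hlt
  · subst heq; simp
  rw [sum_Ioc_mul_eq_abel c s hEE']
  have hsplit : ∑ e ∈ Ico E E', (c (e + 1) - c e) * ∑ i ∈ Ioc E e, s i
      = ∑ e ∈ Ioo E E', (c (e + 1) - c e) * ∑ i ∈ Ioc E e, s i := by
    have hIco : Ico E E' = insert E (Ioo E E') := by
      ext e; simp only [mem_Ico, mem_insert, mem_Ioo]; omega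
    rw [hIco, sum_insert (by simp), Ioc_self, sum_empty, mul_zero, zero_add]
  rw [hsplit]
  refine (norm_sub_le _ _).trans (add_le_add (by rw [norm_mul]) ?_)
  refine (norm_sum_le _ _).trans (sum_le_sum fun e _ => ?_)
  rw [norm_mul]

/-- `∑_{E<e<E'} 1/e ≤ 1` for `E' ≤ 2E`. [folklore] -/
theorem sum_Ioo_one_div_le_one {E E' : ℕ} (hE' : E' ≤ 2 * E) : ∑ e ∈ Ioo E E', 1 / (e : ℝ) ≤ 1 := by
  rcases Nat.eq_zero_or_pos E with rfl | hE
  · simp [Ioo_eq_empty_of_le (show E' ≤ 0 by omega)]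
  have hE0 : (0 : ℝ) < E := by exact_mod_cast hE
  calc ∑ e ∈ Ioo E E', 1 / (e : ℝ) ≤ ∑ _e ∈ Ioo E E', 1 / (E : ℝ) := by
        refine sum_le_sum fun e he => ?_
        rw [mem_Ioo] at he
        exact one_div_le_one_div_of_le hE0 (by exact_mod_cast he.1.le)
    _ = ((E' - E - 1 : ℕ) : ℝ) * (1 / E) := by rw [sum_const, Nat.card_Ioo, nsmul_eq_mul]
    _ ≤ (E : ℝ) * (1 / E) := by
        refine mul_le_mul_of_nonneg_right ?_ (by positivity)
        exact_mod_cast (show E' - E - 1 ≤ E by omega)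
    _ = 1 := by field_simp

/-- `∑_{E<e<E'} 1/e³ ≤ 1/E²` for `E' ≤ 2E`. [folklore] -/
theorem sum_Ioo_one_div_cube_le {E E' : ℕ} (hE' : E' ≤ 2 * E) :
    ∑ e ∈ Ioo E E', 1 / (e : ℝ) ^ 3 ≤ 1 / (E : ℝ) ^ 2 := by
  rcases Nat.eq_zero_or_pos E with rfl | hE
  · simp [Ioo_eq_empty_of_le (show E' ≤ 0 by omega)]
  have hE0 : (0 : ℝ) < E := by exact_mod_cast hE
  calc ∑ e ∈ Ioo E E', 1 / (e : ℝ) ^ 3 ≤ ∑ _e ∈ Ioo E E', 1 / (E : ℝ) ^ 3 := by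
        refine sum_le_sum fun e he => ?_
        rw [mem_Ioo] at he
        have : (E : ℝ) ≤ e := by exact_mod_cast he.1.le
        exact one_div_le_one_div_of_le (by positivity) (pow_le_pow_left₀ hE0.le this 3)
    _ = ((E' - E - 1 : ℕ) : ℝ) * (1 / (E : ℝ) ^ 3) := by rw [sum_const, Nat.card_Ioo, nsmul_eq_mul]
    _ ≤ (E : ℝ) * (1 / (E : ℝ) ^ 3) := by
        refine mul_le_mul_of_nonneg_right ?_ (by positivity)
        exact_mod_cast (show E' - E - 1 ≤ E by omega)
    _ = 1 / (E : ℝ) ^ 2 := by field_simp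

/-- **Abel summation in the modulus against an `ℓ¹`-in-`h` hypothesis, factorised variation.**  For weights
`c_e(h)` with `|c_{E'}(h)| ≤ B₀/h` and `|c_{e+1}(h) − c_e(h)| ≤ W₁/(e·h) + W₂/e³` (`E < e < E'`, `1 ≤ h ≤ H`), and
signals whose partial sums `T_t(h) = ∑_{E<i≤t} s_i(h)` satisfy `∑_{h≤H} |T_t(h)|/h ≤ L₁`, `∑_{h≤H} |T_t(h)| ≤ L₀`
for every `E ≤ t ≤ E'` (`E' ≤ 2E`, `E ≥ 1`):
`∑_{h≤H} |∑_{E<e≤E'} c_e(h)s_e(h)| ≤ B₀L₁ + W₁L₁ + W₂L₀/E²`. [this work] -/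
theorem sum_norm_sum_Ioc_mul_le_of_factorised (c s : ℕ → ℕ → ℂ) {E E' H : ℕ} (hE : 1 ≤ E) (hEE' : E ≤ E')
    (hE' : E' ≤ 2 * E) {B₀ W₁ W₂ L₀ L₁ : ℝ} (hB₀0 : 0 ≤ B₀) (hW₁ : 0 ≤ W₁) (hW₂ : 0 ≤ W₂) (hL₀ : 0 ≤ L₀)
    (hL₁ : 0 ≤ L₁) (hB₀ : ∀ h ∈ Icc 1 H, ‖c E' h‖ ≤ B₀ / h)
    (hB : ∀ e ∈ Ioo E E', ∀ h ∈ Icc 1 H, ‖c (e + 1) h - c e h‖ ≤ W₁ / ((e : ℝ) * h) + W₂ / (e : ℝ) ^ 3)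
    (hT₁ : ∀ t ∈ Icc E E', ∑ h ∈ Icc 1 H, ‖∑ i ∈ Ioc E t, s i h‖ / h ≤ L₁)
    (hT₀ : ∀ t ∈ Icc E E', ∑ h ∈ Icc 1 H, ‖∑ i ∈ Ioc E t, s i h‖ ≤ L₀) :
    ∑ h ∈ Icc 1 H, ‖∑ e ∈ Ioc E E', c e h * s e h‖ ≤ B₀ * L₁ + W₁ * L₁ + W₂ * L₀ / (E : ℝ) ^ 2 := by
  have hE0 : (0 : ℝ) < E := by exact_mod_cast hE
  -- termwise Abel, then exchange the `h`- and `e`-sums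
  have step1 : ∑ h ∈ Icc 1 H, ‖∑ e ∈ Ioc E E', c e h * s e h‖
      ≤ ∑ h ∈ Icc 1 H, ((B₀ / h) * ‖∑ e ∈ Ioc E E', s e h‖
          + ∑ e ∈ Ioo E E', (W₁ / ((e : ℝ) * h) + W₂ / (e : ℝ) ^ 3) * ‖∑ i ∈ Ioc E e, s i h‖) := by
    refine sum_le_sum fun h hh => ?_
    refine (norm_sum_Ioc_mul_le_abel_termwise (fun e => c e h) (fun e => s e h) hEE').trans ?_
    refine add_le_add (mul_le_mul_of_nonneg_right (hB₀ h hh) (norm_nonneg _)) ?_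
    exact sum_le_sum fun e he => mul_le_mul_of_nonneg_right (hB e he h hh) (norm_nonneg _)
  refine step1.trans ?_
  rw [sum_add_distrib, sum_comm]
  -- the boundary term
  have hbd : ∑ h ∈ Icc 1 H, B₀ / h * ‖∑ e ∈ Ioc E E', s e h‖ ≤ B₀ * L₁ := by
    calc ∑ h ∈ Icc 1 H, B₀ / h * ‖∑ e ∈ Ioc E E', s e h‖
        = B₀ * ∑ h ∈ Icc 1 H, ‖∑ e ∈ Ioc E E', s e h‖ / h := by
          rw [mul_sum]; exact sum_congr rfl fun h _ => by ring
      _ ≤ B₀ * L₁ := mul_le_mul_of_nonneg_left (hT₁ E' (mem_Icc.mpr ⟨hEE', le_rfl⟩)) hB₀0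
  -- the variation terms
  have hvar : ∑ e ∈ Ioo E E', ∑ h ∈ Icc 1 H, (W₁ / ((e : ℝ) * h) + W₂ / (e : ℝ) ^ 3) * ‖∑ i ∈ Ioc E e, s i h‖
      ≤ W₁ * L₁ + W₂ * L₀ / (E : ℝ) ^ 2 := by
    have hpt : ∀ e ∈ Ioo E E',
        ∑ h ∈ Icc 1 H, (W₁ / ((e : ℝ) * h) + W₂ / (e : ℝ) ^ 3) * ‖∑ i ∈ Ioc E e, s i h‖
          ≤ W₁ * (1 / (e : ℝ)) * L₁ + W₂ * (1 / (e : ℝ) ^ 3) * L₀ := by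
      intro e he
      have he' : e ∈ Icc E E' := by rw [mem_Ioo] at he; exact mem_Icc.mpr ⟨he.1.le, he.2.le⟩
      have hsplit : ∑ h ∈ Icc 1 H, (W₁ / ((e : ℝ) * h) + W₂ / (e : ℝ) ^ 3) * ‖∑ i ∈ Ioc E e, s i h‖
          = W₁ * (1 / (e : ℝ)) * ∑ h ∈ Icc 1 H, ‖∑ i ∈ Ioc E e, s i h‖ / h
            + W₂ * (1 / (e : ℝ) ^ 3) * ∑ h ∈ Icc 1 H, ‖∑ i ∈ Ioc E e, s i h‖ := by
        rw [mul_sum, mul_sum, ← sum_add_distrib]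
        exact sum_congr rfl fun h _ => by ring
      rw [hsplit]
      exact add_le_add (mul_le_mul_of_nonneg_left (hT₁ e he') (by positivity))
        (mul_le_mul_of_nonneg_left (hT₀ e he') (by positivity))
    refine (sum_le_sum hpt).trans ?_
    rw [sum_add_distrib]
    have e1 : ∑ e ∈ Ioo E E', W₁ * (1 / (e : ℝ)) * L₁ = W₁ * L₁ * ∑ e ∈ Ioo E E', 1 / (e : ℝ) := by
      rw [mul_sum]; exact sum_congr rfl fun e _ => by ring
    have e2 : ∑ e ∈ Ioo E E', W₂ * (1 / (e : ℝ) ^ 3) * L₀ = W₂ * L₀ * ∑ e ∈ Ioo E E', 1 / (e : ℝ) ^ 3 := by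
      rw [mul_sum]; exact sum_congr rfl fun e _ => by ring
    rw [e1, e2]
    have k1 := mul_le_mul_of_nonneg_left (sum_Ioo_one_div_le_one hE') (mul_nonneg hW₁ hL₁)
    have k2 := mul_le_mul_of_nonneg_left (sum_Ioo_one_div_cube_le hE') (mul_nonneg hW₂ hL₀)
    rw [mul_one] at k1
    rw [mul_one_div] at k2
    linarith
  linarith

/-! ### The termwise tail -/

/-- **The tail in the frequency**: for `Φ(N) = Φ(N−1) = 0` with `V₂(Φ) ≤ V`, and `2M₁ ≤ e`, `2M₂ ≤ e`,
`∑_{H<h≤M₁} |K_N(Φ; e(−h/e))| + ∑_{H<k≤M₂} |K_N(Φ; e(k/e))| ≤ V·e²/(4(H+1))`. [this work] -/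
theorem sum_norm_kernelSum_tail_le (N : ℕ) {Φ : ℕ → ℂ} (hN : Φ N = 0) (hN' : Φ (N - 1) = 0) {V : ℝ}
    (hV : ∑ m ∈ range (N + 1), ‖bdiff (bdiff Φ) m‖ ≤ V) {e H M₁ M₂ : ℕ} (hM₁ : 2 * M₁ ≤ e)
    (hM₂ : 2 * M₂ ≤ e) :
    ∑ h ∈ Ioc H M₁, ‖kernelSum N Φ (eAdd e (-(h : ℤ)))‖
        + ∑ k ∈ Ioc H M₂, ‖kernelSum N Φ (eAdd e (-(-(k : ℤ))))‖
      ≤ V * (e : ℝ) ^ 2 / (4 * ((H : ℝ) + 1)) := by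
  have hV0 : 0 ≤ V := (sum_nonneg fun _ _ => norm_nonneg _).trans hV
  have hH1 : (1 : ℕ) ≤ H + 1 := by omega
  have key : ∀ (M : ℕ), 2 * M ≤ e → ∀ (sgn : ℤ), (sgn = 1 ∨ sgn = -1) →
      ∑ h ∈ Ioc H M, ‖kernelSum N Φ (eAdd e (-(sgn * (h : ℤ))))‖ ≤ V * (e : ℝ) ^ 2 / (8 * ((H : ℝ) + 1)) := by
    intro M hM sgn hsgn
    have habs : ∀ h : ℕ, |sgn * (h : ℤ)| = h := by
      intro h; rcases hsgn with rfl | rfl <;> simp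
    have hpt : ∀ h ∈ Ioc H M,
        ‖kernelSum N Φ (eAdd e (-(sgn * (h : ℤ))))‖ ≤ V * ((e : ℝ) ^ 2 / 16) * (1 / (h : ℝ) ^ 2) := by
      intro h hh
      rw [mem_Ioc] at hh
      have hh0 : sgn * (h : ℤ) ≠ 0 := by
        rcases hsgn with rfl | rfl <;> simp <;> omega
      have hh2 : 2 * |sgn * (h : ℤ)| ≤ (e : ℤ) := by rw [habs]; exact_mod_cast (by omega : 2 * h ≤ e)
      refine (norm_kernelSum_eAdd_le_second N hN hN' hh0 hh2).trans ?_
      have hcast : |((sgn * (h : ℤ) : ℤ) : ℝ)| = h := by exact_mod_cast habs h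
      rw [hcast]
      have hh' : (0 : ℝ) < h := by exact_mod_cast (show 0 < h by omega)
      calc (∑ m ∈ range (N + 1), ‖bdiff (bdiff Φ) m‖) * ((e : ℝ) / (4 * (h : ℝ))) ^ 2
          ≤ V * ((e : ℝ) / (4 * (h : ℝ))) ^ 2 := mul_le_mul_of_nonneg_right hV (sq_nonneg _)
        _ = V * ((e : ℝ) ^ 2 / 16) * (1 / (h : ℝ) ^ 2) := by field_simp; ring
    refine (sum_le_sum hpt).trans ?_
    rw [← mul_sum]
    have hsq : ∑ h ∈ Ioc H M, 1 / (h : ℝ) ^ 2 ≤ 2 / ((H : ℝ) + 1) := by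
      have := sum_Icc_one_div_sq_le_two_div hH1 M
      rw [show Icc (H + 1) M = Ioc H M from by ext h; simp [mem_Icc, mem_Ioc]] at this
      push_cast at this
      exact this
    calc V * ((e : ℝ) ^ 2 / 16) * ∑ h ∈ Ioc H M, 1 / (h : ℝ) ^ 2
        ≤ V * ((e : ℝ) ^ 2 / 16) * (2 / ((H : ℝ) + 1)) := mul_le_mul_of_nonneg_left hsq (by positivity)
      _ = V * (e : ℝ) ^ 2 / (8 * ((H : ℝ) + 1)) := by field_simp; ring
  have k1 := key M₁ hM₁ 1 (Or.inl rfl)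
  have k2 := key M₂ hM₂ (-1) (Or.inr rfl)
  simp only [one_mul] at k1
  simp only [neg_mul, one_mul] at k2
  have : V * (e : ℝ) ^ 2 / (8 * ((H : ℝ) + 1)) + V * (e : ℝ) ^ 2 / (8 * ((H : ℝ) + 1))
      = V * (e : ℝ) ^ 2 / (4 * ((H : ℝ) + 1)) := by field_simp; ring
  linarith
end Summit.Parity.BatemanHorn.Theorems
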